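import Summits.Ventures.PercRepro.C041TriDomLeafMark

/-!
# ROW C-041 — THEOREM (THE SIBLING DOMINATION): THE SIBLING DOMINATION HOLDS ON EVERY STATUS OF EVERY HOST
(p6, gen 50; P6-TWOEXIT-LEAN.md §53 ADDENDUM 24)

The SIBLING DOMINATION of the marks `x, y` and a terminal `v` (`SibDominationS`, `C041TriDomGlueClasses`: on every
up-set `#{x ~_R y, x ≁_B y, x ~_B v, y ≁_B v} + #{y ~_R v, y ≁_R x, x ≁_R v, x ~_B y} ≤ #{x ~_R y ~_R v, x ≁_B y}`) was
the second hypothesis of the lane's inductions (`cyc_and_sib_of_noCut`, `cyc_and_sib_of_stockedCore`,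
`cyc_and_sib_of_noDoubleCore`).  It is a THEOREM: hang a new leaf `z₀` at `v` by a new free edge `f₀` (`pendHost`,
`pendSt`), apply COROLLARY (TWO CLASSES) to the marks `(x, y, z₀)` of the extension at the up-set «the old part lies
in `V`», and read the classes off the old host: `(⊤,⊥)` of the extension is «`f₀` red and the sibling target»
(`topBotS_pend`), `(s₁,s₂)` is «`f₀` blue and the first sibling class» (`C12S_pend`), `(s₃,s₁)` is «`f₀` red and the
second sibling class» (`C31S_pend`) — a leaf is red- or blue-attached, never both, so the connectivities of the
extension are those of the old host with the leaf attached in the colour of `f₀` (`RdS_pend_some`, `RdS_pend_none`,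
`MgS_pend_some`, `MgS_pend_none`).  Each slice «`f₀ = c` and an old class» counts exactly like the old class
(`card_pend_slice`).  **THEOREM** `sibDominationS_all : SibDominationS Z₁ x y v st` for every host, status, marks and
terminal (in `C041TriDomPendantSibling`, on this module's extension and connectivity transport).  CONSEQUENCE: in the
lane's reductions the sibling hypothesis is void (paper ADDENDUM 24).  THIS MODULE: the extension `pendHost` / `pendSt`
/ `oldCol`, its adjacencies (`joins_pend_*`, `RAdjS_pend_*`, `BAdjS_pend_*`) and the connectivity transport.
-/

namespace PercRepro

namespace ZoneZ

namespace MultiExit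

open ZoneData Finset

variable {V₁ E₁ U₁ U₂ : Type} (Z₁ : ZoneData V₁ E₁ U₁ U₂) (v : V₁)

/-! ## The extension by a leaf -/

/-- The host `Z₁` with a new leaf `none` hanging at `v` by the new edge `none`; old vertices and edges are `some`. -/
def pendHost : ZoneData (Option V₁) (Option E₁) U₁ U₂ where
  fst := fun e => match e with
    | some e => some (Z₁.fst e)
    | none => some v
  snd := fun e => match e with
    | some e => some (Z₁.snd e)
    | none => none
  at₁ := fun t => some (Z₁.at₁ t)
  at₂ := fun t => some (Z₁.at₂ t)

/-- The status of the extension: `st` on the old edges, `free` on the new one. -/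
def pendSt (st : E₁ → EStat) : Option E₁ → EStat := fun e => match e with
  | some e => st e
  | none => EStat.free

/-- The old part of a colouring of the extension. -/
def oldCol (ω₂ : Option E₁ → Bool) : E₁ → Bool := fun e => ω₂ (some e)

variable (st : E₁ → EStat)

/-- An old edge of the extension joins old vertices as in `Z₁`. -/
theorem joins_pend_some (e : E₁) (a b : V₁) :
    (pendHost Z₁ v).Joins (some e) (some a) (some b) ↔ Z₁.Joins e a b := by
  unfold ZoneData.Joins pendHost
  simp only [Option.some.injEq]

/-- No old edge of the extension touches the leaf. -/
theorem not_joins_pend_some_none (e : E₁) (w : Option V₁) : ¬ (pendHost Z₁ v).Joins (some e) w none := by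
  unfold ZoneData.Joins pendHost
  simp only [reduceCtorEq, and_false, false_and, or_self, not_false_eq_true]

/-- The new edge joins `some a` and `none` iff `a = v`. -/
theorem joins_pend_none (a : V₁) : (pendHost Z₁ v).Joins none (some a) none ↔ a = v := by
  unfold ZoneData.Joins pendHost
  constructor
  · rintro (⟨h, _⟩ | ⟨h, _⟩)
    · exact (Option.some.injEq _ _).mp h |>.symm
    · exact absurd h (by simp)
  · intro h
    exact Or.inl ⟨by rw [h], rfl⟩

/-- The new edge joins no two old vertices. -/
theorem not_joins_pend_none_some (a b : V₁) : ¬ (pendHost Z₁ v).Joins none (some a) (some b) := by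
  unfold ZoneData.Joins pendHost
  simp only [reduceCtorEq, and_false, or_self, not_false_eq_true]

/-- The new edge is not a loop at the leaf. -/
theorem not_joins_pend_none_none : ¬ (pendHost Z₁ v).Joins none none none := by
  unfold ZoneData.Joins pendHost
  simp only [reduceCtorEq, false_and, or_self, not_false_eq_true]

/-- Red adjacency of old vertices in the extension is red adjacency in `Z₁`. -/
theorem RAdjS_pend_some (ω₂ : Option E₁ → Bool) (a b : V₁) :
    RAdjS (pendHost Z₁ v) (pendSt st) ω₂ (some a) (some b) ↔ RAdjS Z₁ st (oldCol ω₂) a b := by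
  unfold RAdjS
  constructor
  · rintro ⟨e, he, hr⟩
    cases e with
    | none => exact absurd he (not_joins_pend_none_some Z₁ v a b)
    | some e => exact ⟨e, (joins_pend_some Z₁ v e a b).mp he, hr⟩
  · rintro ⟨e, he, hr⟩
    exact ⟨some e, (joins_pend_some Z₁ v e a b).mpr he, hr⟩

/-- Blue adjacency of old vertices in the extension is blue adjacency in `Z₁`. -/
theorem BAdjS_pend_some (ω₂ : Option E₁ → Bool) (a b : V₁) :
    BAdjS (pendHost Z₁ v) (pendSt st) ω₂ (some a) (some b) ↔ BAdjS Z₁ st (oldCol ω₂) a b := by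
  unfold BAdjS
  constructor
  · rintro ⟨e, he, hb⟩
    cases e with
    | none => exact absurd he (not_joins_pend_none_some Z₁ v a b)
    | some e => exact ⟨e, (joins_pend_some Z₁ v e a b).mp he, hb⟩
  · rintro ⟨e, he, hb⟩
    exact ⟨some e, (joins_pend_some Z₁ v e a b).mpr he, hb⟩

/-- The leaf is red-adjacent to `some a` iff `a = v` and the new edge is red. -/
theorem RAdjS_pend_none (ω₂ : Option E₁ → Bool) (a : V₁) :
    RAdjS (pendHost Z₁ v) (pendSt st) ω₂ (some a) none ↔ a = v ∧ ω₂ none = true := by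
  unfold RAdjS
  constructor
  · rintro ⟨e, he, hr⟩
    cases e with
    | none =>
      refine ⟨(joins_pend_none Z₁ v a).mp he, ?_⟩
      rcases hr with hr | ⟨_, hr⟩
      · exact absurd hr (by unfold pendSt; simp)
      · exact hr
    | some e => exact absurd he (not_joins_pend_some_none Z₁ v e _)
  · rintro ⟨h, hr⟩
    exact ⟨none, (joins_pend_none Z₁ v a).mpr h, Or.inr ⟨rfl, hr⟩⟩

/-- The leaf is blue-adjacent to `some a` iff `a = v` and the new edge is blue. -/
theorem BAdjS_pend_none (ω₂ : Option E₁ → Bool) (a : V₁) :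
    BAdjS (pendHost Z₁ v) (pendSt st) ω₂ (some a) none ↔ a = v ∧ ω₂ none = false := by
  unfold BAdjS
  constructor
  · rintro ⟨e, he, hb⟩
    cases e with
    | none =>
      refine ⟨(joins_pend_none Z₁ v a).mp he, ?_⟩
      rcases hb with hb | ⟨_, hb⟩
      · exact absurd hb (by unfold pendSt; simp)
      · exact hb
    | some e => exact absurd he (not_joins_pend_some_none Z₁ v e _)
  · rintro ⟨h, hb⟩
    exact ⟨none, (joins_pend_none Z₁ v a).mpr h, Or.inr ⟨rfl, hb⟩⟩

/-- The leaf is not adjacent to itself in red. -/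
theorem not_RAdjS_pend_none_none (ω₂ : Option E₁ → Bool) :
    ¬ RAdjS (pendHost Z₁ v) (pendSt st) ω₂ none none := by
  rintro ⟨e, he, _⟩
  cases e with
  | none => exact not_joins_pend_none_none Z₁ v he
  | some e => exact not_joins_pend_some_none Z₁ v e _ he

/-- The leaf is not adjacent to itself in blue. -/
theorem not_BAdjS_pend_none_none (ω₂ : Option E₁ → Bool) :
    ¬ BAdjS (pendHost Z₁ v) (pendSt st) ω₂ none none := by
  rintro ⟨e, he, _⟩
  cases e with
  | none => exact not_joins_pend_none_none Z₁ v he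
  | some e => exact not_joins_pend_some_none Z₁ v e _ he

/-! ## Connectivity along a leaf

A walk of the extension from an old vertex reaches an old vertex only through old edges, and reaches the leaf only
from `v` through the new edge. -/

/-- The red walks of the extension from `some a`: to `some b` iff `a ~_R b` in `Z₁`, to the leaf iff `a ~_R v` and
the new edge is red. -/
theorem rtg_pend_red (ω₂ : Option E₁ → Bool) (a : V₁) (w : Option V₁)
    (h : Relation.ReflTransGen (RAdjS (pendHost Z₁ v) (pendSt st) ω₂) (some a) w) :
    (∀ b, w = some b → RdS Z₁ st (oldCol ω₂) a b) ∧ (w = none → RdS Z₁ st (oldCol ω₂) a v ∧ ω₂ none = true) := by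
  induction h with
  | refl =>
    refine ⟨fun b hb => ?_, (fun h => nomatch h)⟩
    rw [Option.some.injEq] at hb
    subst hb
    exact RdS_refl' Z₁ st _ a
  | @tail w w' _ hww' ih =>
    cases w with
    | none =>
      cases w' with
      | none => exact absurd hww' (not_RAdjS_pend_none_none Z₁ v st ω₂)
      | some d =>
        obtain ⟨hav, hred⟩ := ih.2 rfl
        have hd : d = v := ((RAdjS_pend_none Z₁ v st ω₂ d).mp (RAdjS_symm _ _ _ _ _ hww')).1
        subst hd
        exact ⟨fun b hb => by rw [Option.some.injEq] at hb; subst hb; exact hav, (fun h => nomatch h)⟩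
    | some c =>
      have hac := ih.1 c rfl
      cases w' with
      | none =>
        obtain ⟨hcv, hred⟩ := (RAdjS_pend_none Z₁ v st ω₂ c).mp hww'
        subst hcv
        exact ⟨(fun b hb => nomatch hb), fun _ => ⟨hac, hred⟩⟩
      | some d =>
        have hcd := (RAdjS_pend_some Z₁ v st ω₂ c d).mp hww'
        refine ⟨fun b hb => ?_, (fun h => nomatch h)⟩
        rw [Option.some.injEq] at hb
        subst hb
        unfold RdS at hac ⊢
        exact reach_trans' hac ((mem_reach_singleton _ _ _).mpr (Relation.ReflTransGen.single hcd))

/-- The blue walks of the extension from `some a`. -/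
theorem rtg_pend_blue (ω₂ : Option E₁ → Bool) (a : V₁) (w : Option V₁)
    (h : Relation.ReflTransGen (BAdjS (pendHost Z₁ v) (pendSt st) ω₂) (some a) w) :
    (∀ b, w = some b → MgS Z₁ st (oldCol ω₂) a b) ∧ (w = none → MgS Z₁ st (oldCol ω₂) a v ∧ ω₂ none = false) := by
  induction h with
  | refl =>
    refine ⟨fun b hb => ?_, (fun h => nomatch h)⟩
    rw [Option.some.injEq] at hb
    subst hb
    exact MgS_refl' Z₁ st _ a
  | @tail w w' _ hww' ih =>
    cases w with
    | none =>
      cases w' with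
      | none => exact absurd hww' (not_BAdjS_pend_none_none Z₁ v st ω₂)
      | some d =>
        obtain ⟨hav, hblue⟩ := ih.2 rfl
        have hd : d = v := ((BAdjS_pend_none Z₁ v st ω₂ d).mp (BAdjS_symm _ _ _ _ _ hww')).1
        subst hd
        exact ⟨fun b hb => by rw [Option.some.injEq] at hb; subst hb; exact hav, (fun h => nomatch h)⟩
    | some c =>
      have hac := ih.1 c rfl
      cases w' with
      | none =>
        obtain ⟨hcv, hblue⟩ := (BAdjS_pend_none Z₁ v st ω₂ c).mp hww'
        subst hcv
        exact ⟨(fun b hb => nomatch hb), fun _ => ⟨hac, hblue⟩⟩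
      | some d =>
        have hcd := (BAdjS_pend_some Z₁ v st ω₂ c d).mp hww'
        refine ⟨fun b hb => ?_, (fun h => nomatch h)⟩
        rw [Option.some.injEq] at hb
        subst hb
        unfold MgS at hac ⊢
        exact reach_trans' hac ((mem_reach_singleton _ _ _).mpr (Relation.ReflTransGen.single hcd))

/-- Red connectivity of old vertices in the extension is red connectivity in `Z₁`. -/
theorem RdS_pend_some (ω₂ : Option E₁ → Bool) (a b : V₁) :
    RdS (pendHost Z₁ v) (pendSt st) ω₂ (some a) (some b) ↔ RdS Z₁ st (oldCol ω₂) a b := by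
  constructor
  · intro h
    unfold RdS at h
    rw [mem_reach_singleton] at h
    exact (rtg_pend_red Z₁ v st ω₂ a _ h).1 b rfl
  · intro h
    unfold RdS at h ⊢
    rw [mem_reach_singleton] at h ⊢
    exact Relation.ReflTransGen.lift some (fun c d hcd => (RAdjS_pend_some Z₁ v st ω₂ c d).mpr hcd) _ _ h

/-- The leaf is red-connected to `some a` iff the new edge is red and `a ~_R v` in `Z₁`. -/
theorem RdS_pend_none (ω₂ : Option E₁ → Bool) (a : V₁) :
    RdS (pendHost Z₁ v) (pendSt st) ω₂ (some a) none ↔ ω₂ none = true ∧ RdS Z₁ st (oldCol ω₂) a v := by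
  constructor
  · intro h
    unfold RdS at h
    rw [mem_reach_singleton] at h
    exact ((rtg_pend_red Z₁ v st ω₂ a _ h).2 rfl).symm
  · rintro ⟨hred, hav⟩
    have h := (RdS_pend_some Z₁ v st ω₂ a v).mpr hav
    unfold RdS at h ⊢
    rw [mem_reach_singleton] at h ⊢
    exact h.tail ((RAdjS_pend_none Z₁ v st ω₂ v).mpr ⟨rfl, hred⟩)

/-- Blue connectivity of old vertices in the extension is blue connectivity in `Z₁`. -/
theorem MgS_pend_some (ω₂ : Option E₁ → Bool) (a b : V₁) :
    MgS (pendHost Z₁ v) (pendSt st) ω₂ (some a) (some b) ↔ MgS Z₁ st (oldCol ω₂) a b := by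
  constructor
  · intro h
    unfold MgS at h
    rw [mem_reach_singleton] at h
    exact (rtg_pend_blue Z₁ v st ω₂ a _ h).1 b rfl
  · intro h
    unfold MgS at h ⊢
    rw [mem_reach_singleton] at h ⊢
    exact Relation.ReflTransGen.lift some (fun c d hcd => (BAdjS_pend_some Z₁ v st ω₂ c d).mpr hcd) _ _ h

/-- The leaf is blue-connected to `some a` iff the new edge is blue and `a ~_B v` in `Z₁`. -/
theorem MgS_pend_none (ω₂ : Option E₁ → Bool) (a : V₁) :
    MgS (pendHost Z₁ v) (pendSt st) ω₂ (some a) none ↔ ω₂ none = false ∧ MgS Z₁ st (oldCol ω₂) a v := by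
  constructor
  · intro h
    unfold MgS at h
    rw [mem_reach_singleton] at h
    exact ((rtg_pend_blue Z₁ v st ω₂ a _ h).2 rfl).symm
  · rintro ⟨hblue, hav⟩
    have h := (MgS_pend_some Z₁ v st ω₂ a v).mpr hav
    unfold MgS at h ⊢
    rw [mem_reach_singleton] at h ⊢
    exact h.tail ((BAdjS_pend_none Z₁ v st ω₂ v).mpr ⟨rfl, hblue⟩)

end MultiExit

end ZoneZ

end PercRepro
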